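import Literature.NumberTheory.LFunctions.WeilExplicit

/-!
# RiemannHypothesis / SpectralTrace — definitions posited by line `pick-slope` of the crux `WindowTracePrime2`

Route `RiemannHypothesis/SpectralTrace`, crux item `WindowTracePrime2` (stmt-RiemannHypothesis-11196), line
`pick-slope` (skeleton `Cruxes/WindowTracePrime2/Lines/pick_slope.lean`, registered stubs `stub_positivity`,
`stub_resolvent`, `stub_massLaw`, `stub_pickSlope`). This file collects the DEFINITIONS the line posits, verbatim
from the checked skeleton, so that the stub proofs landing under `Theorems/` (`--supports stmt-RiemannHypothesis-11196`)
import them instead of restating them (line card, Definition request D1′):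

* `PickSlope.Realises S w` — a locally finite atomic realisation of the window-`(log 3)` Weil distribution with real
  weights (`Σ_{x ∈ S} w(x) ĝ(1/2 + ix) = W(g)` as a `HasSum`, for every Weil test supported in `[-log 3, log 3]`);
* `PickSlope.PickParam` (+ `poles`, `val`, `slope`, `weight`) — real-axis data of a meromorphic Herglotz
  (Pick–Nevanlinna) function in Chebotarev–Levin form `τ(t) = a t + b + Σ_k c_k (1/(s_k - t) - s_k/(1 + s_k²))`;
* `PickSlope.Resolvent` (+ `κ`, `mfun`, `atoms`, `invMass`) — real-axis resolvent data `(A B; C D)`, `AD - BC = 1`,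
  of a Nevanlinna parametrisation, with the atom set / point masses of the solution each parameter labels;
* `PickSlope.Resolvent.IsNevanlinna` — the CLAIM that `R` is a Nevanlinna parametrisation of the locally finite
  atomic solutions of the window-`(log 3)` problem (the interface delivered by `stub_resolvent`).

The only theorem is the registered sanity stub `stub_defs` (`C ≠ 0 ∨ D ≠ 0` from `det = 1`). References: M. G. Kreĭn, H. Langer, *Continuation of Hermitian
positive definite functions and related questions*, IEOT 78 (2014) [KreinLanger2013]; B. Ja. Levin, *Distribution
of zeros of entire functions* (AMS 1964), Ch. VII (Chebotarev's theorem) [Levin1964]; N. I. Akhiezer, *The classical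
moment problem* (1965), Ch. 3 (Nevanlinna parametrisation).
-/

noncomputable section

open Complex Set Filter
open scoped Topology BigOperators

set_option linter.dupNamespace false

namespace Summit.RiemannHypothesis.RiemannHypothesis.Theorems.PickSlope

open Literature.NumberTheory.LFunctions

/-! ## The vocabulary of the line -/

/-- A locally finite atomic REALISATION of the window-`(log 3)` Weil distribution with real weights `w` on the
atom set `S`: `Σ_{x ∈ S} w(x) ĝ(1/2 + ix) = W(g)` (as a `HasSum`) for every Weil test `g` supported in
`[-log 3, log 3]`. With `w = 1` this is literally the crux for the family `S ↪ ℝ`. [folklore] -/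
def Realises (S : Set ℝ) (w : ℝ → ℝ) : Prop :=
  ∀ g : ℝ → ℂ, IsWeilTest g → tsupport g ⊆ Icc (-Real.log 3) (Real.log 3) →
    HasSum (fun x : S => ((w x : ℝ) : ℂ) * weilMellin g (1 / 2 + ((x : ℝ) : ℂ) * I)) (weilFunctional g)

/-- Real-axis data of a MEROMORPHIC HERGLOTZ (Pick–Nevanlinna) function with real simple poles
(Chebotarev–Levin form): `τ(t) = a t + b + Σ_k c_k (1/(s_k - t) - s_k/(1 + s_k²))` with `a ≥ 0`, `c_k > 0`,
distinct locally finite poles `s_k` and `Σ_k c_k/(1 + s_k²) < ∞`. The index type `ι` may be empty or finite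
(real constants, rational Herglotz functions). [cite: Levin1964, Ch. VII (Chebotarev's theorem on real meromorphic functions mapping ℂ⁺ to ℂ⁺)] -/
structure PickParam where
  /-- index set of the poles -/
  ι : Type
  /-- linear coefficient (`≥ 0`) -/
  a : ℝ
  /-- real constant -/
  b : ℝ
  /-- the poles -/
  s : ι → ℝ
  /-- the (positive) weights: `τ(z) ∼ c_k/(s_k - z)` at `s_k` -/
  c : ι → ℝ
  /-- `a ≥ 0` -/
  a_nonneg : 0 ≤ a
  /-- `c_k > 0` -/
  c_pos : ∀ k, 0 < c k
  /-- the poles are distinct -/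
  s_injective : Function.Injective s
  /-- the poles are locally finite -/
  poles_locallyFinite : ∀ K : ℝ, {k | |s k| ≤ K}.Finite
  /-- `Σ_k c_k/(1 + s_k²) < ∞` -/
  summable : Summable fun k => c k / (1 + s k ^ 2)

namespace PickParam

variable (τ : PickParam)

/-- The pole set of `τ`. [folklore] -/
def poles : Set ℝ := range τ.s

/-- `τ(t)` on the real axis (junk, but finite, at the poles). [folklore] -/
def val (t : ℝ) : ℝ :=
  τ.a * t + τ.b + ∑' k, τ.c k * (1 / (τ.s k - t) - τ.s k / (1 + τ.s k ^ 2))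

/-- `τ′(t)` off the poles: `a + Σ_k c_k/(s_k - t)²` (`> 0` unless `τ` is constant). [folklore] -/
def slope (t : ℝ) : ℝ :=
  τ.a + ∑' k, τ.c k / (τ.s k - t) ^ 2

open Classical in
/-- The weight `c_k` at a pole `t = s_k` (junk `0` off the poles). [folklore] -/
def weight (t : ℝ) : ℝ :=
  if h : ∃ k, τ.s k = t then τ.c h.choose else 0

end PickParam

/-- REAL-AXIS RESOLVENT DATA of a Nevanlinna parametrisation of the window-`(log 3)` problem: four real
differentiable functions with `AD - BC = 1` (restrictions of the real entire resolvent matrix), and, for each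
parameter `p` (`some τ` = a meromorphic Herglotz function, `none` = the parameter `∞`), the atom set `supp p`
and the point masses `mass p` of the solution `μ_p` it labels. Nothing is claimed here; the claims are
`Resolvent.IsNevanlinna`. [cite: KreinLanger2013, §§1-3 (continuation of p.d. / screw functions from an interval, resolvent matrix of the indeterminate problem)] -/
structure Resolvent where
  /-- entry `A` of the resolvent matrix on the real axis -/
  A : ℝ → ℝ
  /-- entry `B` -/
  B : ℝ → ℝ
  /-- entry `C` -/
  C : ℝ → ℝ
  /-- entry `D` -/
  D : ℝ → ℝ
  /-- `A` is differentiable -/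
  differentiable_A : Differentiable ℝ A
  /-- `B` is differentiable -/
  differentiable_B : Differentiable ℝ B
  /-- `C` is differentiable -/
  differentiable_C : Differentiable ℝ C
  /-- `D` is differentiable -/
  differentiable_D : Differentiable ℝ D
  /-- `AD - BC = 1` -/
  det : ∀ t, A t * D t - B t * C t = 1
  /-- atoms of the solution `μ_p` labelled by the parameter `p` -/
  supp : Option PickParam → Set ℝ
  /-- point masses of `μ_p` (junk off `supp p`) -/
  mass : Option PickParam → ℝ → ℝ

namespace Resolvent

variable (R : Resolvent)

/-- `κ := C D′ - C′ D` (the Wronskian; `= K_L(t,t)`, the reciprocal Weil–Christoffel function, for the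
genuine resolvent). [folklore] -/
def κ (t : ℝ) : ℝ := R.C t * deriv R.D t - deriv R.C t * R.D t

/-- The Möbius image of the parameter on the real axis: `m_τ = (Aτ + B)/(Cτ + D)`, `m_∞ = A/C`
(junk values at its poles are irrelevant: only punctured limits are used). [folklore] -/
def mfun : Option PickParam → ℝ → ℝ
  | none, t => R.A t / R.C t
  | some τ, t => (R.A t * τ.val t + R.B t) / (R.C t * τ.val t + R.D t)

/-- CROSSING SET of the parameter with `Θ = -D/C` on `P¹(ℝ)`: off the poles of `τ`, the zeros of `Cτ + D`;
at a pole of `τ` (where `τ = ∞`), the zeros of `C` (where `Θ = ∞`); for `p = ∞`, the zeros of `C`. [folklore] -/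
def atoms : Option PickParam → Set ℝ
  | none => {t | R.C t = 0}
  | some τ => {t | (t ∉ τ.poles ∧ R.C t * τ.val t + R.D t = 0) ∨ (t ∈ τ.poles ∧ R.C t = 0)}

open Classical in
/-- RECIPROCAL MASS predicted by the mass law at a crossing: `κ + C² τ′` off the poles of `τ`,
`κ + D²/c_k` at a pole `s_k` of `τ` with `C(s_k) = 0`, and `κ` for the parameter `∞`. [folklore] -/
def invMass : Option PickParam → ℝ → ℝ
  | none, t => R.κ t
  | some τ, t => if t ∈ τ.poles then R.κ t + R.D t ^ 2 / τ.weight t else R.κ t + R.C t ^ 2 * τ.slope t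

/-- `R` IS A NEVANLINNA PARAMETRISATION of the locally finite atomic solutions of the window-`(log 3)`
problem: `κ > 0`; every parameter labels a positive, locally finite atomic realisation; its point masses are
the residues of `m_p` on the real axis (so `m_p` is the restriction of the regularised Cauchy transform of
`μ_p` up to an entire real part — normalisation-free); and every positive locally finite atomic realisation is
labelled. [cite: KreinLanger2013, §§1-3 (resolvent matrix of the indeterminate continuation problem; Nevanlinna parametrisation, cf. Akhiezer 1965 Ch. 3)] -/
structure IsNevanlinna (R : Resolvent) : Prop where
  /-- `κ > 0` everywhere -/
  kappa_pos : ∀ t, 0 < R.κ t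
  /-- the labelled point masses are positive -/
  mass_pos : ∀ p, ∀ x ∈ R.supp p, 0 < R.mass p x
  /-- the labelled atom sets are locally finite -/
  locallyFinite : ∀ (p) (K : ℝ), (R.supp p ∩ Icc (-K) K).Finite
  /-- every parameter labels a realisation -/
  realises : ∀ p, Realises (R.supp p) (R.mass p)
  /-- the point masses are the real-axis residues of `m_p` -/
  residue : ∀ (p) (x : ℝ),
    Tendsto (fun t => (x - t) * R.mfun p t) (𝓝[≠] x) (𝓝 ((R.supp p).indicator (R.mass p) x))
  /-- every positive locally finite atomic realisation is labelled -/
  complete : ∀ (S : Set ℝ) (w : ℝ → ℝ), (∀ x ∈ S, 0 < w x) → (∀ K : ℝ, (S ∩ Icc (-K) K).Finite) →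
    Realises S w → ∃ p, R.supp p = S ∧ ∀ x ∈ S, R.mass p x = w x

end Resolvent

/-! ## The definitions-file obligation `stub_defs` -/

/-- **`stub_defs`** (registered stub of the line `pick-slope`, crux stmt-RiemannHypothesis-11196): the resolvent
data never degenerate on the real axis — `C(t) ≠ 0 ∨ D(t) ≠ 0` — immediate from `AD - BC = 1`. It is the sanity
theorem that travels with this definitions file. [folklore] -/
theorem stub_defs : ∀ (R : Resolvent) (t : ℝ), R.C t ≠ 0 ∨ R.D t ≠ 0 := by
  intro R t
  by_cases hC : R.C t = 0
  · right
    intro hD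
    have hdet := R.det t
    rw [hC, hD, mul_zero, mul_zero, sub_zero] at hdet
    exact zero_ne_one hdet
  · exact Or.inl hC

end Summit.RiemannHypothesis.RiemannHypothesis.Theorems.PickSlope

end
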